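import Mathlib
import Literature.Geometry.Lorentzian.KerrConvergence
import Literature.Geometry.Lorentzian.KerrSchild

/-!
# Route StarvedNecks — crux `GapDecaySuffices` (stmt-FinalStateConjecture-18060), line `Sketch`:
# entry of connected coordinate sets into the gap chart's tube (location brick for S4)

The ENTRY step of the registered stub `stub_anchoredLocation` (S4, `AnchoredLocation`) of the line
skeleton `Cruxes/GapDecaySuffices/Lines/Sketch.lean`, isolated as def-free topological bricks over
abstract open embeddings and the verbatim G1 / G5 shapes of the gap certificate.

* `entry_bootstrap` — **clopen continuation with an a-priori bootstrap.**  A map `h` (the gap chart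
  `Ψg`) whose restriction to `U` is an open embedding, a set `A ⊆ U` (a closed sub-wall tube
  portion) whose image is closed relative to `O` (`closure (h '' A) ∩ O ⊆ h '' A`, clause G5), a map
  `φ` (the flat chart `Φ`, or a hole chart) continuous on a preconnected parameter set `K` with
  `φ '' K ⊆ O`, an OPEN condition `V ⊆ E × P` ("`x` in the open tube and weakly located w.r.t. the
  parameter") and a CLOSED condition `C` ("strongly located") such that on `K`: weak ⟹ strong for
  preimages in `U` (the a-priori estimate), strong ⟹ weak for preimages in `A` (the improved bound
  clears the rim of the tube with a margin), and one seed.  Then every `φ k`, `k ∈ K`, is `h x` for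
  an `x ∈ U` satisfying both conditions.  Proof: the set of good parameters is relatively open
  (open embedding + openness of `V`), relatively closed (G5 + closedness of `C` + injectivity), and
  non-empty in the preconnected `K`.
* `entry_of_noRimContact` — the special case without bootstrap (`V = U₀ × P`, `C = ⊤`): located +
  seeded + connected ⟹ entered.
* `entry_gapTube`, `flat_entry_gapTube`, `hole_entry_gapTube` — the same for the gap chart `Ψg` of
  hole `i` of a final-state decomposition `d` with the verbatim G1 open-embedding tube
  `U = {τ₁ < tᵢ, rᵢ < W(x⁰) + 1}`, a G5-closed tube portion `A = {τ' ≤ tᵢ, rᵢ ≤ ϱ(tᵢ)}` and its open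
  core `U₀ = {τ' < tᵢ, rᵢ < ϱ(tᵢ)}`, the parameter map being an arbitrary continuous `φ`, the flat
  chart `Φ` on a preconnected set of late coordinate points of the flat domain, or a hole chart `Ψⱼ`
  on a preconnected set of late points of its model domain (both map late points into `O`,
  `IsLateChart.image_subset`).

What S4 still needs on top of these bricks is the NO-RIM-CONTACT input (coarse location of common
points of the two charts) and the seed; see the worker's report in `work/stubs/StubAnchoredLocationV2.lean`.
Mathlib + `Literature.Geometry.Lorentzian.KerrConvergence` / `KerrSchild` only; no definitions, no
named facts.  References: the clopen ("continuity") method, e.g. Gilbarg–Trudinger, *Elliptic PDE of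
second order*, Thm. 5.2 (method of continuity); O'Neill 1983, Ch. 14 (causality of Kerr / Minkowski
charts) for the shapes of the tubes.
-/

noncomputable section

open scoped Manifold ContDiff Topology
open Filter Set Topology Literature.Geometry.Lorentzian

namespace Summit.FinalStateConjecture.FinalStateConjecture.Theorems.GapDecaySuffices.Location

set_option linter.dupNamespace false

section Abstract

/-- Images of relatively open subsets `N ∩ U` of `U` under a map whose restriction to `U` is an open
embedding are open. [folklore] -/
theorem isOpen_image_inter_of_isOpenEmbedding_restrict {E F : Type*} [TopologicalSpace E]
    [TopologicalSpace F] {h : E → F} {U : Set E}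
    (hemb : IsOpenEmbedding (U.restrict h)) {N : Set E} (hN : IsOpen N) :
    IsOpen (h '' (N ∩ U)) := by
  have : h '' (N ∩ U) = U.restrict h '' (Subtype.val ⁻¹' N) := by
    apply Subset.antisymm
    · rintro _ ⟨x, ⟨hxN, hxU⟩, rfl⟩
      exact ⟨⟨x, hxU⟩, hxN, rfl⟩
    · rintro _ ⟨⟨x, hxU⟩, hxN, rfl⟩
      exact ⟨x, ⟨hxN, hxU⟩, rfl⟩
  rw [this]
  exact hemb.isOpenMap _ (hN.preimage continuous_subtype_val)

/-- **Local persistence of entry.**  If `h x₀ = φ k₀` with `x₀ ∈ U`, `h` an open embedding on `U`,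
`φ` continuous within `K` at `k₀`, and `(x₀, k₀)` lies in an open set `W`, then every `k` near `k₀`
within `K` has `φ k = h x` for some `x ∈ U` with `(x, k) ∈ W`. [folklore] -/
theorem eventually_exists_preimage_mem {E P F : Type*} [TopologicalSpace E] [TopologicalSpace P]
    [TopologicalSpace F] {h : E → F} {U : Set E}
    (hemb : IsOpenEmbedding (U.restrict h)) {φ : P → F} {K : Set P} {k₀ : P}
    (hφ : ContinuousWithinAt φ K k₀) {x₀ : E} (hx₀ : x₀ ∈ U) (hhx₀ : h x₀ = φ k₀)
    {W : Set (E × P)} (hW : IsOpen W) (hxk : (x₀, k₀) ∈ W) :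
    ∀ᶠ k in 𝓝[K] k₀, ∃ x ∈ U, h x = φ k ∧ (x, k) ∈ W := by
  obtain ⟨Nx, Nk, hNx, hNk, hx₀N, hk₀N, hsub⟩ := isOpen_prod_iff.1 hW x₀ k₀ hxk
  have h1 : h '' (Nx ∩ U) ∈ 𝓝 (φ k₀) :=
    (isOpen_image_inter_of_isOpenEmbedding_restrict hemb hNx).mem_nhds ⟨x₀, ⟨hx₀N, hx₀⟩, hhx₀⟩
  have h2 : ∀ᶠ k in 𝓝[K] k₀, φ k ∈ h '' (Nx ∩ U) := hφ h1
  have h3 : ∀ᶠ k in 𝓝[K] k₀, k ∈ Nk := mem_nhdsWithin_of_mem_nhds (hNk.mem_nhds hk₀N)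
  filter_upwards [h2, h3] with k hk hkN
  obtain ⟨x, ⟨hxN, hxU⟩, hx⟩ := hk
  exact ⟨x, hxU, hx, hsub (mk_mem_prod hxN hkN)⟩

/-- **Clopen continuation with an a-priori bootstrap** (entry brick for S4 of line `Sketch`, crux
`GapDecaySuffices`).  Data: `h : E → F` with `U.restrict h` an open embedding (the gap chart on its
tube, G1); `A ⊆ U` with `closure (h '' A) ∩ O ⊆ h '' A` (a sub-wall tube portion, G5); a map
`φ : P → F` continuous on a preconnected `K` with `φ '' K ⊆ O` (the flat chart on a connected set of
late-flat coordinate points); an open `V ⊆ E × P` and a closed `C ⊆ E × P` such that, for `k ∈ K`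
and `h x = φ k`: `x ∈ U`, `(x, k) ∈ V` ⟹ `x ∈ A` and `(x, k) ∈ C` (the a-priori estimate: weakly
located preimages in the open tube are strongly located), and `x ∈ A`, `(x, k) ∈ C` ⟹ `(x, k) ∈ V`
(strongly located preimages in the closed tube clear its rim); and a seed `k ∈ K` with a preimage
in `U` satisfying `V`.  Conclusion: every `k ∈ K` has a preimage `x ∈ U`, `h x = φ k`, satisfying
`V` and `C`.  The set of good parameters is relatively open (`eventually_exists_preimage_mem`),
relatively closed (G5, closedness of `C`, injectivity of `h` on `U`) and non-empty in the
preconnected `K`. [folklore] -/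
theorem entry_bootstrap {E P F : Type*} [TopologicalSpace E] [TopologicalSpace P]
    [TopologicalSpace F] {h : E → F} {U A : Set E} {O : Set F} {φ : P → F} {K : Set P}
    {V C : Set (E × P)}
    (hemb : IsOpenEmbedding (U.restrict h)) (hAU : A ⊆ U)
    (hclos : closure (h '' A) ∩ O ⊆ h '' A)
    (hK : IsPreconnected K) (hφ : ContinuousOn φ K) (hKO : ∀ k ∈ K, φ k ∈ O)
    (hV : IsOpen V) (hC : IsClosed C)
    (hVA : ∀ k ∈ K, ∀ x ∈ U, h x = φ k → (x, k) ∈ V → x ∈ A)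
    (himp : ∀ k ∈ K, ∀ x ∈ U, h x = φ k → (x, k) ∈ V → (x, k) ∈ C)
    (hclear : ∀ k ∈ K, ∀ x ∈ A, h x = φ k → (x, k) ∈ C → (x, k) ∈ V)
    (hseed : ∃ k ∈ K, ∃ x ∈ U, h x = φ k ∧ (x, k) ∈ V) :
    ∀ k ∈ K, ∃ x ∈ U, h x = φ k ∧ (x, k) ∈ V ∧ (x, k) ∈ C := by
  -- injectivity of `h` on `U`
  have hinj : ∀ x ∈ U, ∀ x' ∈ U, h x = h x' → x = x' := fun x hx x' hx' hxx' ↦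
    congrArg Subtype.val (hemb.injective (a₁ := ⟨x, hx⟩) (a₂ := ⟨x', hx'⟩) hxx')
  -- the good parameters
  set good : Set P := {k | k ∈ K ∧ ∃ x ∈ U, h x = φ k ∧ (x, k) ∈ V} with hgood
  have hgoodK : good ⊆ K := fun k hk ↦ hk.1
  -- relatively open
  have hopen : ∀ k₀ ∈ good, ∀ᶠ k in 𝓝[K] k₀, k ∈ good := by
    rintro k₀ ⟨hk₀K, x₀, hx₀U, hhx₀, hxkV⟩
    filter_upwards [eventually_exists_preimage_mem hemb (hφ k₀ hk₀K) hx₀U hhx₀ hV hxkV,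
      self_mem_nhdsWithin] with k hk hkK
    exact ⟨hkK, hk⟩
  -- relatively closed
  have hclosed : ∀ k ∈ K, k ∈ closure good → k ∈ good := by
    intro k hkK hkcl
    have hgA : φ '' good ⊆ h '' A := by
      rintro _ ⟨k', ⟨hk'K, x', hx'U, hhx', hx'V⟩, rfl⟩
      exact ⟨x', hVA k' hk'K x' hx'U hhx' hx'V, hhx'⟩
    have h1 : φ k ∈ closure (h '' A) :=
      closure_mono hgA (((hφ k hkK).mono hgoodK).mem_closure_image hkcl)
    obtain ⟨x, hxA, hhx⟩ := hclos ⟨h1, hKO k hkK⟩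
    have hxU : x ∈ U := hAU hxA
    have hxC : (x, k) ∈ C := by
      by_contra hxC
      have hev := eventually_exists_preimage_mem hemb (hφ k hkK) hxU hhx hC.isOpen_compl hxC
      have hev' : ∀ᶠ k' in 𝓝[good] k, k' ∈ good ∧ ∃ x' ∈ U, h x' = φ k' ∧ (x', k') ∈ Cᶜ :=
        (show ∀ᶠ k' in 𝓝[good] k, k' ∈ good from self_mem_nhdsWithin).and
          (hev.filter_mono (nhdsWithin_mono k hgoodK))
      haveI : (𝓝[good] k).NeBot := mem_closure_iff_nhdsWithin_neBot.1 hkcl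
      obtain ⟨k', ⟨hk'K, x'', hx''U, hhx'', hx''V⟩, x', hx'U, hhx', hx'C⟩ := hev'.exists
      obtain rfl : x' = x'' := hinj x' hx'U x'' hx''U (hhx'.trans hhx''.symm)
      exact hx'C (himp k' hk'K x' hx''U hhx'' hx''V)
    exact ⟨hkK, x, hxU, hhx, hclear k hkK x hxA hhx hxC⟩
  -- an open set cutting `good` out of `K`
  have hrelopen : ∃ U' : Set P, IsOpen U' ∧ good = K ∩ U' := by
    choose! u hu using fun k₀ (hk₀ : k₀ ∈ good) ↦ mem_nhdsWithin.1 (hopen k₀ hk₀)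
    refine ⟨⋃ k₀ ∈ good, u k₀, isOpen_biUnion fun k₀ hk₀ ↦ (hu k₀ hk₀).1, ?_⟩
    apply Subset.antisymm
    · intro k hk
      exact ⟨hgoodK hk, mem_biUnion hk (hu k hk).2.1⟩
    · rintro k ⟨hkK, hkU⟩
      obtain ⟨k₀, hk₀, hku⟩ := mem_iUnion₂.1 hkU
      exact (hu k₀ hk₀).2.2 ⟨hku, hkK⟩
  obtain ⟨U', hU'open, hgoodeq⟩ := hrelopen
  obtain ⟨k₁, hk₁K, x₁, hx₁U, hhx₁, hx₁V⟩ := hseed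
  have hk₁good : k₁ ∈ good := ⟨hk₁K, x₁, hx₁U, hhx₁, hx₁V⟩
  -- the clopen argument in the preconnected `K`
  have hKgood : K ⊆ good := by
    intro k hkK
    by_contra hk
    have hkcl : k ∉ closure good := fun hkcl ↦ hk (hclosed k hkK hkcl)
    have hcover : K ⊆ U' ∪ (closure good)ᶜ := by
      intro k' hk'K
      by_cases hk'cl : k' ∈ closure good
      · have hg : k' ∈ good := hclosed k' hk'K hk'cl
        rw [hgoodeq] at hg
        exact Or.inl hg.2
      · exact Or.inr hk'cl
    have hk₁U : k₁ ∈ K ∩ U' := by rw [← hgoodeq]; exact hk₁good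
    obtain ⟨k', hk'K, hk'U, hk'cl⟩ := hK U' (closure good)ᶜ hU'open
      isClosed_closure.isOpen_compl hcover ⟨k₁, hk₁K, hk₁U.2⟩ ⟨k, hkK, hkcl⟩
    have hg : k' ∈ good := by rw [hgoodeq]; exact ⟨hk'K, hk'U⟩
    exact hk'cl (subset_closure hg)
  intro k hkK
  obtain ⟨-, x, hxU, hhx, hxV⟩ := hKgood hkK
  exact ⟨x, hxU, hhx, hxV, himp k hkK x hxU hhx hxV⟩

/-- **Located + seeded + connected ⟹ entered** (the bootstrap-free case of `entry_bootstrap`).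
With `U₀ ⊆ A ⊆ U`, `U₀` open, `h` an open embedding on `U`, `h '' A` closed relative to `O`,
`φ` continuous on the preconnected `K` with values in `O`: if every preimage in `A` of a point
`φ k`, `k ∈ K`, lies in `U₀` (no rim contact) and some `φ k` has a preimage in `U₀`, then every
`φ k` has one. [folklore] -/
theorem entry_of_noRimContact {E P F : Type*} [TopologicalSpace E] [TopologicalSpace P]
    [TopologicalSpace F] {h : E → F} {U A U₀ : Set E} {O : Set F} {φ : P → F} {K : Set P}
    (hemb : IsOpenEmbedding (U.restrict h)) (hAU : A ⊆ U) (hU₀A : U₀ ⊆ A) (hU₀ : IsOpen U₀)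
    (hclos : closure (h '' A) ∩ O ⊆ h '' A)
    (hK : IsPreconnected K) (hφ : ContinuousOn φ K) (hKO : ∀ k ∈ K, φ k ∈ O)
    (hrim : ∀ k ∈ K, ∀ x ∈ A, h x = φ k → x ∈ U₀)
    (hseed : ∃ k ∈ K, ∃ x ∈ U₀, h x = φ k) :
    ∀ k ∈ K, ∃ x ∈ U₀, h x = φ k := by
  have H := entry_bootstrap (V := U₀ ×ˢ (univ : Set P)) (C := univ) hemb hAU hclos hK hφ hKO
    (hU₀.prod isOpen_univ) isClosed_univ
    (fun _ _ _ _ _ hxV ↦ hU₀A (mem_prod.1 hxV).1) (fun _ _ _ _ _ _ ↦ mem_univ _)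
    (fun k hk x hxA hhx _ ↦ mk_mem_prod (hrim k hk x hxA hhx) (mem_univ _))
    (by
      obtain ⟨k, hk, x, hxU₀, hhx⟩ := hseed
      exact ⟨k, hk, x, hAU (hU₀A hxU₀), hhx, mk_mem_prod hxU₀ (mem_univ _)⟩)
  intro k hk
  obtain ⟨x, -, hhx, hxV, -⟩ := H k hk
  exact ⟨x, (mem_prod.1 hxV).1, hhx⟩

end Abstract

/-! ## The bricks in the shapes of the gap certificate (G1, G5) -/

section GapTube

/-- **Entry into the gap chart's open tube.**  Let `Ψg` be a chart on the model domain of hole `i`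
of a final-state decomposition `d` whose restriction to the tube `U = {τ₁ < tᵢ, rᵢ < W(x⁰) + 1}` is
an open embedding (G1), let `A = {τ' ≤ tᵢ, rᵢ ≤ ϱ(tᵢ)}` (`τ₁ < τ'`, `ϱ` continuous, sub-wall:
`rᵢ ≤ ϱ(tᵢ) ⟹ rᵢ ≤ W(x⁰)` on `A`) have image closed relative to `O` (G5), and let `φ` be
continuous on a preconnected `K` with values in `O`.  If no point `φ p`, `p ∈ K`, is the image of
a RIM point of `A` (`tᵢ = τ'` or `rᵢ = ϱ(tᵢ)`), and one `φ p` is the image of a point of the open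
core `U₀ = {τ' < tᵢ, rᵢ < ϱ(tᵢ)}`, then all of `φ '' K` lies in `Ψg '' U₀`. [folklore] -/
theorem entry_gapTube {𝓢 : Spacetime.{0} 4} {O : Set 𝓢.carrier} {k : ℕ}
    (d : FinalStateDecomposition 𝓢 O k) (i : Fin d.N) {τ₁ τ' : ℝ}
    {W ϱ : ℝ → ℝ} {Ψg : (d.background i).domain → 𝓢.carrier}
    (hemb : IsOpenEmbedding ({x : (d.background i).domain | τ₁ < (d.background i).time x.1 ∧
        (d.background i).radius x.1 < W (x.1 0) + 1}.restrict Ψg))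
    (hclos : closure (Ψg '' {x | τ' ≤ (d.background i).time x.1 ∧
        (d.background i).radius x.1 ≤ ϱ ((d.background i).time x.1)}) ∩ O ⊆
      Ψg '' {x | τ' ≤ (d.background i).time x.1 ∧
        (d.background i).radius x.1 ≤ ϱ ((d.background i).time x.1)})
    (hϱ : Continuous ϱ) (hτ : τ₁ < τ')
    (hϱW : ∀ x : (d.background i).domain, τ' ≤ (d.background i).time x.1 →
      (d.background i).radius x.1 ≤ ϱ ((d.background i).time x.1) →
      (d.background i).radius x.1 ≤ W (x.1 0))
    {P : Type*} [TopologicalSpace P] {φ : P → 𝓢.carrier} {K : Set P}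
    (hK : IsPreconnected K) (hφ : ContinuousOn φ K) (hKO : ∀ p ∈ K, φ p ∈ O)
    (hrim : ∀ p ∈ K, ∀ x : (d.background i).domain, τ' ≤ (d.background i).time x.1 →
      (d.background i).radius x.1 ≤ ϱ ((d.background i).time x.1) → Ψg x = φ p →
      τ' < (d.background i).time x.1 ∧
        (d.background i).radius x.1 < ϱ ((d.background i).time x.1))
    (hseed : ∃ p ∈ K, ∃ x : (d.background i).domain, τ' < (d.background i).time x.1 ∧
      (d.background i).radius x.1 < ϱ ((d.background i).time x.1) ∧ Ψg x = φ p) :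
    ∀ p ∈ K, ∃ x : (d.background i).domain, τ' < (d.background i).time x.1 ∧
      (d.background i).radius x.1 < ϱ ((d.background i).time x.1) ∧ Ψg x = φ p := by
  have htc : Continuous (d.background i).time :=
    (PiLp.continuous_apply 2 _ 0).comp (continuous_poincareInv (d.motion i).1 (d.motion i).2)
  have hrc : Continuous (d.background i).radius :=
    (Kerr.continuous_radius _).comp (continuous_poincareInv (d.motion i).1 (d.motion i).2)
  have hU₀ : IsOpen {x : (d.background i).domain | τ' < (d.background i).time x.1 ∧
      (d.background i).radius x.1 < ϱ ((d.background i).time x.1)} :=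
    (isOpen_lt continuous_const (htc.comp continuous_subtype_val)).inter
      (isOpen_lt (hrc.comp continuous_subtype_val)
        (hϱ.comp (htc.comp continuous_subtype_val)))
  have H := entry_of_noRimContact (O := O) (φ := φ)
    (U := {x : (d.background i).domain | τ₁ < (d.background i).time x.1 ∧
      (d.background i).radius x.1 < W (x.1 0) + 1})
    (A := {x | τ' ≤ (d.background i).time x.1 ∧
      (d.background i).radius x.1 ≤ ϱ ((d.background i).time x.1)})
    (U₀ := {x : (d.background i).domain | τ' < (d.background i).time x.1 ∧
      (d.background i).radius x.1 < ϱ ((d.background i).time x.1)})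
    hemb (fun x hx ↦ ⟨lt_of_lt_of_le hτ hx.1, by linarith [hϱW x hx.1 hx.2]⟩)
    (fun x hx ↦ ⟨hx.1.le, hx.2.le⟩) hU₀ hclos hK hφ hKO
    (fun p hp x hx hhx ↦ hrim p hp x hx.1 hx.2 hhx)
    (by
      obtain ⟨p, hp, x, hx1, hx2, hhx⟩ := hseed
      exact ⟨p, hp, x, ⟨hx1, hx2⟩, hhx⟩)
  intro p hp
  obtain ⟨x, ⟨hx1, hx2⟩, hhx⟩ := H p hp
  exact ⟨x, hx1, hx2, hhx⟩

/-- **Entry of a connected set of late-flat coordinate points** (the form consumed by S4): as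
`entry_gapTube`, the parameter map being the flat chart `Φ = d.flatChart` on a preconnected set
`S ⊆ E4` of coordinate points of the flat domain with `τ₀ < y⁰` (continuity: `IsLateChart.contMDiff`;
values in `O`: `IsLateChart.image_subset`). [folklore] -/
theorem flat_entry_gapTube {𝓢 : Spacetime.{0} 4} {O : Set 𝓢.carrier} {k : ℕ}
    (d : FinalStateDecomposition 𝓢 O k) (i : Fin d.N) {τ₁ τ' : ℝ}
    {W ϱ : ℝ → ℝ} {Ψg : (d.background i).domain → 𝓢.carrier}
    (hemb : IsOpenEmbedding ({x : (d.background i).domain | τ₁ < (d.background i).time x.1 ∧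
        (d.background i).radius x.1 < W (x.1 0) + 1}.restrict Ψg))
    (hclos : closure (Ψg '' {x | τ' ≤ (d.background i).time x.1 ∧
        (d.background i).radius x.1 ≤ ϱ ((d.background i).time x.1)}) ∩ O ⊆
      Ψg '' {x | τ' ≤ (d.background i).time x.1 ∧
        (d.background i).radius x.1 ≤ ϱ ((d.background i).time x.1)})
    (hϱ : Continuous ϱ) (hτ : τ₁ < τ')
    (hϱW : ∀ x : (d.background i).domain, τ' ≤ (d.background i).time x.1 →
      (d.background i).radius x.1 ≤ ϱ ((d.background i).time x.1) →
      (d.background i).radius x.1 ≤ W (x.1 0))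
    {S : Set E4} (hS : IsPreconnected S) (hSf : S ⊆ d.flatDomain) (hlate : ∀ y ∈ S, d.τ₀ < y 0)
    (hrim : ∀ y (hy : y ∈ S), ∀ x : (d.background i).domain, τ' ≤ (d.background i).time x.1 →
      (d.background i).radius x.1 ≤ ϱ ((d.background i).time x.1) →
      Ψg x = d.flatChart ⟨y, hSf hy⟩ →
      τ' < (d.background i).time x.1 ∧
        (d.background i).radius x.1 < ϱ ((d.background i).time x.1))
    (hseed : ∃ (y : E4) (hy : y ∈ S) (x : (d.background i).domain),
      τ' < (d.background i).time x.1 ∧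
        (d.background i).radius x.1 < ϱ ((d.background i).time x.1) ∧
        Ψg x = d.flatChart ⟨y, hSf hy⟩) :
    ∀ y (hy : y ∈ S), ∃ x : (d.background i).domain, τ' < (d.background i).time x.1 ∧
      (d.background i).radius x.1 < ϱ ((d.background i).time x.1) ∧
      Ψg x = d.flatChart ⟨y, hSf hy⟩ := by
  -- the set `S`, read in the flat domain
  set K : Set d.flatDomain := Subtype.val ⁻¹' S with hK
  have hKS : Subtype.val '' K = S := by
    apply Subset.antisymm
    · rintro _ ⟨y, hy, rfl⟩
      exact hy
    · intro y hy
      exact ⟨⟨y, hSf hy⟩, hy, rfl⟩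
  have hKpre : IsPreconnected K :=
    (Topology.IsInducing.subtypeVal.isPreconnected_image).1 (hKS ▸ hS)
  have H := entry_gapTube d i hemb hclos hϱ hτ hϱW (φ := d.flatChart) (K := K) hKpre
    d.isLateChart_flat.contMDiff.continuous.continuousOn
    (fun y hy ↦ d.isLateChart_flat.image_subset ⟨y, hlate y.1 hy, rfl⟩)
    (fun y hy x hx1 hx2 hhx ↦ hrim y.1 hy x hx1 hx2 hhx)
    (by
      obtain ⟨y, hy, x, hx1, hx2, hhx⟩ := hseed
      exact ⟨⟨y, hSf hy⟩, hy, x, hx1, hx2, hhx⟩)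
  intro y hy
  exact H ⟨y, hSf hy⟩ hy

/-- **Entry of a connected set of late points of a hole chart** (the form consumed by the transport
of the anchor of S4 through the input hole chart): as `entry_gapTube`, the parameter map being the
input hole chart `Ψⱼ = d.chart j` on a preconnected set of points of its model domain with
`τ₀ < tⱼ`. [folklore] -/
theorem hole_entry_gapTube {𝓢 : Spacetime.{0} 4} {O : Set 𝓢.carrier} {k : ℕ}
    (d : FinalStateDecomposition 𝓢 O k) (i : Fin d.N) {τ₁ τ' : ℝ}
    {W ϱ : ℝ → ℝ} {Ψg : (d.background i).domain → 𝓢.carrier}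
    (hemb : IsOpenEmbedding ({x : (d.background i).domain | τ₁ < (d.background i).time x.1 ∧
        (d.background i).radius x.1 < W (x.1 0) + 1}.restrict Ψg))
    (hclos : closure (Ψg '' {x | τ' ≤ (d.background i).time x.1 ∧
        (d.background i).radius x.1 ≤ ϱ ((d.background i).time x.1)}) ∩ O ⊆
      Ψg '' {x | τ' ≤ (d.background i).time x.1 ∧
        (d.background i).radius x.1 ≤ ϱ ((d.background i).time x.1)})
    (hϱ : Continuous ϱ) (hτ : τ₁ < τ')
    (hϱW : ∀ x : (d.background i).domain, τ' ≤ (d.background i).time x.1 →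
      (d.background i).radius x.1 ≤ ϱ ((d.background i).time x.1) →
      (d.background i).radius x.1 ≤ W (x.1 0))
    (j : Fin d.N) {K : Set (d.background j).domain} (hK : IsPreconnected K)
    (hlate : ∀ z ∈ K, d.τ₀ < (d.background j).time z.1)
    (hrim : ∀ z ∈ K, ∀ x : (d.background i).domain, τ' ≤ (d.background i).time x.1 →
      (d.background i).radius x.1 ≤ ϱ ((d.background i).time x.1) → Ψg x = d.chart j z →
      τ' < (d.background i).time x.1 ∧
        (d.background i).radius x.1 < ϱ ((d.background i).time x.1))
    (hseed : ∃ z ∈ K, ∃ x : (d.background i).domain, τ' < (d.background i).time x.1 ∧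
      (d.background i).radius x.1 < ϱ ((d.background i).time x.1) ∧ Ψg x = d.chart j z) :
    ∀ z ∈ K, ∃ x : (d.background i).domain, τ' < (d.background i).time x.1 ∧
      (d.background i).radius x.1 < ϱ ((d.background i).time x.1) ∧ Ψg x = d.chart j z :=
  entry_gapTube d i hemb hclos hϱ hτ hϱW hK (d.isLateChart j).contMDiff.continuous.continuousOn
    (fun z hz ↦ (d.isLateChart j).image_subset ⟨z, hlate z hz, rfl⟩) hrim hseed

end GapTube

end Summit.FinalStateConjecture.FinalStateConjecture.Theorems.GapDecaySuffices.Location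

end
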